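import Summits.CriticalPhenomena.CardyFormulaZ2.Theorems.CardySelfDualSegmentUniformMarginalityRestatedRoute
import Summits.CriticalPhenomena.CardyFormulaZ2.Theorems.CardySelfDualSegmentQuarterTurnPinning

/-!
# `CardyFormulaZ2` from THREE statements about the corner family on RECTILINEAR domains
(crux `UniformMarginality`, stmt-CriticalPhenomena-5472, line `Sketch`; lead prover-line-stmt-CriticalPhenomena-5472-c2-0)

Where the route `CardySelfDualSegment` stands after the minimal restatement recommended by this line
(`…UniformMarginalityRestatedRoute.lean`, p137735): of the hypotheses of the restated deciding theorem
`closes_of_rectilinearMarginality`, `SmirnovBasePoint` (`smirnovBasePoint_proof`), `QuarterTurnPinning`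
(`quarterTurnPinning_proof`) and `CrudeToCanonical` (`CrudeToCanonical_holds`) are PROVED in the tree, and
`SegmentClosed` in restated form is `segmentClosed_of_rectilinearMarginality` (p137582). Hence the sub-problem
statement `CardyFormulaZ2` — Cardy's formula for critical bond percolation on `ℤ²` — follows from exactly three
research statements about the self-dual corner family `M_t`:

* SegmentOpen_rect — `G` is open, assuming marginality on rectilinear conformal rectangles;
* UM_rect — quantitative marginality on rectilinear conformal rectangles (stub (B₁) of line `Sketch`);
* UBC — the uniform box-crossing property of `M_t`, `t ∈ [0,1]` (route crux `UniformBoxCrossing`, stmt-5476),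

and so do the route's `Target` and the crux `UniformMarginality` AS FILED (all conformal rectangles).
-/

noncomputable section

open Set Filter
open scoped Topology
open Literature.Probability.RandomPlanarGeometry Literature.Probability.Percolation
open Literature.Probability.LatticeModels Literature.Barriers.CriticalPhenomena

namespace Summit.CriticalPhenomena.CardyFormulaZ2.Cruxes.UniformMarginality.HeatFlow

open Summit.CriticalPhenomena.CardyFormulaZ2.Theorems (smirnovBasePoint_proof quarterTurnPinning_proof)
open Summit.CriticalPhenomena.CardyFormulaZ2.Theses.CardySelfDualSegment (CrudeToCanonical_holds)

/-- **Cardy's formula on `ℤ²` from three rectilinear-domain statements about the corner family**: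
SegmentOpen_rect → UM_rect → UBC → `CardyFormulaZ2` (the restated deciding theorem with its three proved
hypotheses `SmirnovBasePoint`, `QuarterTurnPinning`, `CrudeToCanonical` discharged). -/
theorem cardyFormulaZ2_of_rectilinearCruxes :
    ((∀ (t₀ : unitInterval) (R : ConformalRectangle),
        (∃ S : Finset (ℂ × ℂ), (∀ p ∈ S, p.1.re = p.2.re ∨ p.1.im = p.2.im) ∧
          frontier R.carrier ⊆ ⋃ p ∈ S, segment ℝ p.1 p.2) →
        ∀ ε : ℝ, 0 < ε → ∃ η > 0, ∀ t : unitInterval, dist t t₀ < η → ∀ δ : ℝ, 0 < δ →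
          |Literature.Probability.Percolation.cornerCrossingProb t R δ -
            Literature.Probability.Percolation.cornerCrossingProb t₀ R δ| < ε) →
      IsOpen {t : unitInterval | ∃ α : ℂ, 0 < α.im ∧
        ∀ (R R' : ConformalRectangle)
          (φ : Literature.Probability.RandomPlanarGeometry.ConformalEquiv UpperHalfPlane.upperHalfPlaneSet R.carrier)
          (x : Fin 4 → ℝ),
          R.carrier = Literature.Barriers.CriticalPhenomena.moduliShear α '' R'.carrier →
          (∀ i, R.pt i = Literature.Barriers.CriticalPhenomena.moduliShear α (R'.pt i)) →
          R.IsUniformizing φ x →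
          Filter.Tendsto (Literature.Probability.Percolation.cornerCrossingProb t R') (nhdsWithin 0 (Set.Ioi 0))
            (nhds (Literature.Probability.RandomPlanarGeometry.cardyFunction
              (Literature.Probability.RandomPlanarGeometry.crossRatio x)))}) →
    (∀ (t₀ : unitInterval) (R : ConformalRectangle),
      (∃ S : Finset (ℂ × ℂ), (∀ p ∈ S, p.1.re = p.2.re ∨ p.1.im = p.2.im) ∧
        frontier R.carrier ⊆ ⋃ p ∈ S, segment ℝ p.1 p.2) →
      ∀ ε : ℝ, 0 < ε → ∃ η > 0, ∀ t : unitInterval, dist t t₀ < η → ∀ δ : ℝ, 0 < δ →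
        |Literature.Probability.Percolation.cornerCrossingProb t R δ -
          Literature.Probability.Percolation.cornerCrossingProb t₀ R δ| < ε) →
    (∀ ρ : ℝ, 0 < ρ → ∃ c > 0, ∃ n₀ : ℕ, ∀ t : unitInterval,
      Literature.Probability.LatticeModels.BoxCrossingBounds
        (Literature.Probability.Percolation.cornerPercolation t)
        Literature.Probability.LatticeModels.squareLatticeEmbedding.z ρ c n₀) →
    _root_.CardyFormulaZ2 :=
  fun hO hM hX => closes_of_rectilinearMarginality hO hM hX smirnovBasePoint_proof
    quarterTurnPinning_proof CrudeToCanonical_holds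

/-- The route's `Target` (linear universality along the whole segment) from the same three statements. -/
theorem target_of_rectilinearCruxes :
    ((∀ (t₀ : unitInterval) (R : ConformalRectangle),
        (∃ S : Finset (ℂ × ℂ), (∀ p ∈ S, p.1.re = p.2.re ∨ p.1.im = p.2.im) ∧
          frontier R.carrier ⊆ ⋃ p ∈ S, segment ℝ p.1 p.2) →
        ∀ ε : ℝ, 0 < ε → ∃ η > 0, ∀ t : unitInterval, dist t t₀ < η → ∀ δ : ℝ, 0 < δ →
          |Literature.Probability.Percolation.cornerCrossingProb t R δ -
            Literature.Probability.Percolation.cornerCrossingProb t₀ R δ| < ε) →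
      IsOpen {t : unitInterval | ∃ α : ℂ, 0 < α.im ∧
        ∀ (R R' : ConformalRectangle)
          (φ : Literature.Probability.RandomPlanarGeometry.ConformalEquiv UpperHalfPlane.upperHalfPlaneSet R.carrier)
          (x : Fin 4 → ℝ),
          R.carrier = Literature.Barriers.CriticalPhenomena.moduliShear α '' R'.carrier →
          (∀ i, R.pt i = Literature.Barriers.CriticalPhenomena.moduliShear α (R'.pt i)) →
          R.IsUniformizing φ x →
          Filter.Tendsto (Literature.Probability.Percolation.cornerCrossingProb t R') (nhdsWithin 0 (Set.Ioi 0))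
            (nhds (Literature.Probability.RandomPlanarGeometry.cardyFunction
              (Literature.Probability.RandomPlanarGeometry.crossRatio x)))}) →
    (∀ (t₀ : unitInterval) (R : ConformalRectangle),
      (∃ S : Finset (ℂ × ℂ), (∀ p ∈ S, p.1.re = p.2.re ∨ p.1.im = p.2.im) ∧
        frontier R.carrier ⊆ ⋃ p ∈ S, segment ℝ p.1 p.2) →
      ∀ ε : ℝ, 0 < ε → ∃ η > 0, ∀ t : unitInterval, dist t t₀ < η → ∀ δ : ℝ, 0 < δ →
        |Literature.Probability.Percolation.cornerCrossingProb t R δ -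
          Literature.Probability.Percolation.cornerCrossingProb t₀ R δ| < ε) →
    (∀ ρ : ℝ, 0 < ρ → ∃ c > 0, ∃ n₀ : ℕ, ∀ t : unitInterval,
      Literature.Probability.LatticeModels.BoxCrossingBounds
        (Literature.Probability.Percolation.cornerPercolation t)
        Literature.Probability.LatticeModels.squareLatticeEmbedding.z ρ c n₀) →
    Summit.CriticalPhenomena.CardyFormulaZ2.Theses.CardySelfDualSegment.Target :=
  fun hO hM hX => target_of_rectilinearMarginality hO hM hX smirnovBasePoint_proof

/-- The crux `UniformMarginality` AS FILED (every conformal rectangle) from the same three statements. -/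
theorem uniformMarginality_of_rectilinearCruxes :
    ((∀ (t₀ : unitInterval) (R : ConformalRectangle),
        (∃ S : Finset (ℂ × ℂ), (∀ p ∈ S, p.1.re = p.2.re ∨ p.1.im = p.2.im) ∧
          frontier R.carrier ⊆ ⋃ p ∈ S, segment ℝ p.1 p.2) →
        ∀ ε : ℝ, 0 < ε → ∃ η > 0, ∀ t : unitInterval, dist t t₀ < η → ∀ δ : ℝ, 0 < δ →
          |Literature.Probability.Percolation.cornerCrossingProb t R δ -
            Literature.Probability.Percolation.cornerCrossingProb t₀ R δ| < ε) →
      IsOpen {t : unitInterval | ∃ α : ℂ, 0 < α.im ∧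
        ∀ (R R' : ConformalRectangle)
          (φ : Literature.Probability.RandomPlanarGeometry.ConformalEquiv UpperHalfPlane.upperHalfPlaneSet R.carrier)
          (x : Fin 4 → ℝ),
          R.carrier = Literature.Barriers.CriticalPhenomena.moduliShear α '' R'.carrier →
          (∀ i, R.pt i = Literature.Barriers.CriticalPhenomena.moduliShear α (R'.pt i)) →
          R.IsUniformizing φ x →
          Filter.Tendsto (Literature.Probability.Percolation.cornerCrossingProb t R') (nhdsWithin 0 (Set.Ioi 0))
            (nhds (Literature.Probability.RandomPlanarGeometry.cardyFunction
              (Literature.Probability.RandomPlanarGeometry.crossRatio x)))}) →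
    (∀ (t₀ : unitInterval) (R : ConformalRectangle),
      (∃ S : Finset (ℂ × ℂ), (∀ p ∈ S, p.1.re = p.2.re ∨ p.1.im = p.2.im) ∧
        frontier R.carrier ⊆ ⋃ p ∈ S, segment ℝ p.1 p.2) →
      ∀ ε : ℝ, 0 < ε → ∃ η > 0, ∀ t : unitInterval, dist t t₀ < η → ∀ δ : ℝ, 0 < δ →
        |Literature.Probability.Percolation.cornerCrossingProb t R δ -
          Literature.Probability.Percolation.cornerCrossingProb t₀ R δ| < ε) →
    (∀ ρ : ℝ, 0 < ρ → ∃ c > 0, ∃ n₀ : ℕ, ∀ t : unitInterval,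
      Literature.Probability.LatticeModels.BoxCrossingBounds
        (Literature.Probability.Percolation.cornerPercolation t)
        Literature.Probability.LatticeModels.squareLatticeEmbedding.z ρ c n₀) →
    Summit.CriticalPhenomena.CardyFormulaZ2.Theses.CardySelfDualSegment.UniformMarginality :=
  fun hO hM hX => uniformMarginality_of_restatedCruxes hO hM hX smirnovBasePoint_proof

end Summit.CriticalPhenomena.CardyFormulaZ2.Cruxes.UniformMarginality.HeatFlow

end
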